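import Summits.QuantumAdvantage.QuantumAdvantage.Theorems.CubicForrelationNearExactIsExactSecondWeight
import Summits.QuantumAdvantage.QuantumAdvantage.Theorems.NearExactIsExact.Negative.NoCaseATwelve
import Summits.QuantumAdvantage.QuantumAdvantage.Theorems.CubicForrelationNearExactIsExactTwelveWindowPairing

/-!
# Crux `CubicForrelation.NearExactIsExact` (stmt-QuantumAdvantage-14043) — n = 12: the PROFILE BOUND — a weight bound for a Boolean
  function from symplectic frames of its derivatives

Certificate seat `b2b-cforr-cert` (gen 33).  HONEST FRAMING: kernel-checked elementary counting lemmas (standard axioms) on 12 bits — the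
formal half of the proposed endgame for the one remaining statement "E1280-even" of the open window `(57/64, 29/32)` of the 12-bit
cubic-Forrelation slice (…TwelveDigitClass, HOME/b2b-cforr-cert-g33/PLAN-N12-E1280.md §6).  Nothing about `θ₁₂` is claimed here; NOT
summit progress.

* `tdq_frame_card` (**symplectic frame ⇒ balance**): if a Boolean `q` on 12 bits admits `h` pairs `(bᵢ, cᵢ)` with second derivatives
  `D_{cᵢ}D_{bᵢ} q ≡ 1`, `D_{cⱼ}D_{bᵢ} q ≡ 0 (i ≠ j)`, `D_{bⱼ}D_{bᵢ} q ≡ 0` (a symplectic frame of the alternating form of a quadratic `q`,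
  but no degree hypothesis is needed), then `2048 − 2^{11−h} ≤ #{q = 1} ≤ 2048 + 2^{11−h}` (`|bias q| ≤ 2^{12−h}`): pairing `x ↔ x ⊕ b_k`
  kills the sum of `(−1)^q` outside `{D_{b_k}q = 0}`, and `x ↦ x ⊕ c_k` halves that set.
* `tdq_profile_bound`: for any Boolean `κ` with `e = #{κ = 1}` and any lower bounds `2048 − N(a) ≤ #{x : κ x ≠ κ(x ⊕ a)}` (`a ≠ 0`):
  `4095·2048 ≤ 2e(4096 − e) + Σ_{a ≠ 0} N(a)` (`sw_sum_deriv_card`: `Σ_a #{D_aκ = 1} = 2e(4096 − e)`).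
* `tdq_weight_window_of_profile`: hence `Σ_{a≠0} N(a) ≤ 1202303 ⇒ 1273 ≤ e ≤ 2823`.
USE (paper, PLAN-N12-E1280 §6): for the digit class `κ` of a type-O cubic `g` with cubic 3-graph `C`, `D_aκ` is a quadratic whose
alternating form is the slice `ι_a C*` of the matching dual (…TwelveDigitDualForm), so frames of size `rank(ι_a C*)/2` exist and
`N(a) = 2^{11 − rank(ι_a C*)/2}` is admissible: the PROFILE `P(C*) := Σ_{a≠0} 2^{11 − rank(ι_a C*)/2}` alone bounds `e`; for the class of four
disjoint monomials `P = 837760` gives `e ≥ 1400` (tight).  CONJECTURE P (`P(C*) ≤ 837760` whenever `#PM(C)` is odd; 4·10⁴ samples, no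
exception) would give `e ≥ 1400` for every type-O cubic, hence `θ₁₂ = 57/64`.

References: L. E. Dickson (1901) / MacWilliams–Sloane (1977) Ch. 15 (quadratic forms over 𝔽₂); C. Carlet (2021) §2.2.  Axioms: the
standard three.
-/

set_option linter.dupNamespace false -- D-0017: single-problem summit ⇒ `QuantumAdvantage.QuantumAdvantage` by design

noncomputable section

namespace Summit.QuantumAdvantage.QuantumAdvantage.Theorems.CubicForrelation.NearExactIsExact

open Finset
open Literature.Computability.QuantumComplexity
open Literature.Computability.QuantumComplexity.BuzetChailloux (bxor zeroVec bxor_zeroVec)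

section Profile

variable (q : (Fin (6 + 6) → Bool) → Bool)

/-- **Symplectic frame ⇒ balance.**  If a Boolean `q` on 12 bits has directions `b₀,…,b_{h−1}`, `c₀,…,c_{h−1}` with
`q(x) ⊕ q(x⊕bᵢ) ⊕ q(x⊕cᵢ) ⊕ q(x⊕bᵢ⊕cᵢ) = 1`, `q(x) ⊕ q(x⊕bᵢ) ⊕ q(x⊕cⱼ) ⊕ q(x⊕bᵢ⊕cⱼ) = 0` for `i ≠ j`, and
`q(x) ⊕ q(x⊕bᵢ) ⊕ q(x⊕bⱼ) ⊕ q(x⊕bᵢ⊕bⱼ) = 0` for all `i, j` (all `x`), then `2048 − 2^{11−h} ≤ #{q = 1} ≤ 2048 + 2^{11−h}`.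
[this work] -/
theorem tdq_frame_card (h : ℕ) (hh : h ≤ 11) (b c : Fin h → (Fin (6 + 6) → Bool))
    (hbc : ∀ i x, ((q x ^^ q (bxor x (b i))) ^^ (q (bxor x (c i)) ^^ q (bxor (bxor x (c i)) (b i)))) = true)
    (hbc' : ∀ i j x, i ≠ j → ((q x ^^ q (bxor x (b i))) ^^ (q (bxor x (c j)) ^^ q (bxor (bxor x (c j)) (b i)))) = false)
    (hbb : ∀ i j x, ((q x ^^ q (bxor x (b i))) ^^ (q (bxor x (b j)) ^^ q (bxor (bxor x (b j)) (b i)))) = false) :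
    2048 - 2 ^ (11 - h) ≤ #(univ.filter fun x : Fin (6 + 6) → Bool => q x = true) ∧
      #(univ.filter fun x : Fin (6 + 6) → Bool => q x = true) ≤ 2048 + 2 ^ (11 - h) := by
  -- the derivative in direction `b i`
  set D : Fin h → (Fin (6 + 6) → Bool) → Bool := fun i x => q x ^^ q (bxor x (b i)) with hDdef
  -- invariances
  have hDb : ∀ i j x, D i (bxor x (b j)) = D i x := by
    intro i j x
    have e := hbb i j x
    rw [hDdef]; simp only
    revert e
    cases q x <;> cases q (bxor x (b i)) <;> cases q (bxor x (b j)) <;> cases q (bxor (bxor x (b j)) (b i)) <;> simp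
  have hDc' : ∀ i j x, i ≠ j → D i (bxor x (c j)) = D i x := by
    intro i j x hij
    have e := hbc' i j x hij
    rw [hDdef]; simp only
    revert e
    cases q x <;> cases q (bxor x (b i)) <;> cases q (bxor x (c j)) <;> cases q (bxor (bxor x (c j)) (b i)) <;> simp
  have hDc : ∀ i x, D i (bxor x (c i)) = !(D i x) := by
    intro i x
    have e := hbc i x
    rw [hDdef]; simp only
    revert e
    cases q x <;> cases q (bxor x (b i)) <;> cases q (bxor x (c i)) <;> cases q (bxor (bxor x (c i)) (b i)) <;> simp
  -- the nested sets `Z_k = {x : D_i q x = 0 for i < k}`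
  set Z : ℕ → Finset (Fin (6 + 6) → Bool) := fun k => univ.filter fun x => ∀ i : Fin h, i.val < k → D i x = false with hZdef
  -- (A) the signed sum of `q` lives on `Z_k`, (B) `#Z_k · 2^k = 4096`
  have key : ∀ k, k ≤ h →
      (∑ x, (if q x = true then (-1 : ℤ) else 1)) = ∑ x ∈ Z k, (if q x = true then (-1 : ℤ) else 1) ∧ #(Z k) * 2 ^ k = 4096 := by
    intro k
    induction k with
    | zero =>
      intro _
      have hZ0 : Z 0 = univ := by
        rw [hZdef]; ext x; simp
      rw [hZ0, pow_zero, mul_one, card_univ, Fintype.card_fun, Fintype.card_bool, Fintype.card_fin]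
      exact ⟨rfl, by norm_num⟩
    | succ k ih =>
      intro hk
      obtain ⟨ihA, ihB⟩ := ih (Nat.le_of_succ_le hk)
      have hkh : k < h := hk
      set i₀ : Fin h := ⟨k, hkh⟩ with hi₀
      -- split `Z k` along `D i₀`
      have hZsucc : Z (k + 1) = (Z k).filter fun x => D i₀ x = false := by
        rw [hZdef]; ext x
        simp only [mem_filter, mem_univ, true_and]
        constructor
        · intro hx
          exact ⟨fun i hi => hx i (Nat.lt_succ_of_lt hi), hx i₀ (by rw [hi₀]; exact Nat.lt_succ_self k)⟩
        · rintro ⟨hx, h0⟩ i hi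
          rcases Nat.lt_succ_iff_lt_or_eq.1 hi with hlt | heq
          · exact hx i hlt
          · have : i = i₀ := Fin.ext (by rw [hi₀]; exact heq)
            rw [this]; exact h0
      -- (A): the part of the sum over `Z k ∩ {D i₀ = 1}` vanishes (involution `x ↦ x ⊕ b i₀`)
      have hA : ∑ x ∈ (Z k).filter (fun x => D i₀ x = true), (if q x = true then (-1 : ℤ) else 1) = 0 := by
        refine Finset.sum_involution (fun x _ => bxor x (b i₀)) (fun x hx => ?_) (fun x hx _ => ?_) (fun x hx => ?_)
          (fun x _ => tw59_bxor_cancel_right x (b i₀))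
        · -- values cancel: `q (x ⊕ b) = ¬ q x` on `{D i₀ = 1}`
          have hD1 : D i₀ x = true := (mem_filter.1 hx).2
          rw [hDdef] at hD1; simp only at hD1
          revert hD1
          cases q x <;> cases q (bxor x (b i₀)) <;> simp
        · -- no fixed points
          have hD1 : D i₀ x = true := (mem_filter.1 hx).2
          intro hfix
          rw [hDdef] at hD1; simp only at hD1
          rw [hfix] at hD1
          revert hD1; cases q x <;> simp
        · -- the set is invariant
          obtain ⟨hxZ, hD1⟩ := mem_filter.1 hx
          refine mem_filter.2 ⟨?_, by rw [hDb]; exact hD1⟩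
          rw [hZdef] at hxZ ⊢
          simp only [mem_filter, mem_univ, true_and] at hxZ ⊢
          intro i hi
          rw [hDb]; exact hxZ i hi
      have hsumZ : ∑ x ∈ Z k, (if q x = true then (-1 : ℤ) else 1) = ∑ x ∈ Z (k + 1), (if q x = true then (-1 : ℤ) else 1) := by
        rw [← sum_filter_add_sum_filter_not (Z k) (fun x => D i₀ x = true), hA, zero_add, hZsucc]
        refine sum_congr ?_ fun _ _ => rfl
        ext x; simp only [mem_filter, Bool.not_eq_true]
      -- (B): `x ↦ x ⊕ c i₀` swaps the two halves of `Z k`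
      have hB : #((Z k).filter fun x => D i₀ x = false) = #((Z k).filter fun x => D i₀ x = true) := by
        have himg : ((Z k).filter fun x => D i₀ x = true) = ((Z k).filter fun x => D i₀ x = false).image (fun x => bxor x (c i₀)) := by
          ext y
          simp only [mem_filter, mem_image]
          constructor
          · rintro ⟨hyZ, hD1⟩
            refine ⟨bxor y (c i₀), ⟨?_, ?_⟩, tw59_bxor_cancel_right y (c i₀)⟩
            · rw [hZdef] at hyZ ⊢
              simp only [mem_filter, mem_univ, true_and] at hyZ ⊢
              intro i hi
              have hne : i ≠ i₀ := by
                intro heq; rw [heq, hi₀] at hi; exact lt_irrefl k hi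
              rw [hDc' i i₀ y hne]; exact hyZ i hi
            · rw [hDc, hD1]; rfl
          · rintro ⟨x, ⟨hxZ, hD0⟩, rfl⟩
            refine ⟨?_, by rw [hDc, hD0]; rfl⟩
            rw [hZdef] at hxZ ⊢
            simp only [mem_filter, mem_univ, true_and] at hxZ ⊢
            intro i hi
            have hne : i ≠ i₀ := by
              intro heq; rw [heq, hi₀] at hi; exact lt_irrefl k hi
            rw [hDc' i i₀ x hne]; exact hxZ i hi
        have hinj : Function.Injective (fun x : Fin (6 + 6) → Bool => bxor x (c i₀)) := by
          intro x y hxy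
          have e := congrArg (fun z : Fin (6 + 6) → Bool => bxor z (c i₀)) hxy
          simp only [tw59_bxor_cancel_right] at e
          exact e
        rw [himg, card_image_of_injective _ hinj]
      have hcard : #(Z (k + 1)) * 2 ^ (k + 1) = 4096 := by
        have hsplit := card_filter_add_card_filter_not (s := Z k) (fun x => D i₀ x = false)
        have hnot : ((Z k).filter fun x => ¬ D i₀ x = false) = ((Z k).filter fun x => D i₀ x = true) := by
          refine filter_congr fun x _ => ?_
          cases D i₀ x <;> simp
        rw [hnot, ← hB, ← hZsucc] at hsplit
        rw [pow_succ, ← ihB, ← hsplit]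
        ring
      exact ⟨ihA.trans hsumZ, hcard⟩
  obtain ⟨hA, hB⟩ := key h le_rfl
  -- `|Σ (−1)^q| ≤ #Z_h = 2^{12−h}`
  have hZcard : #(Z h) = 2 ^ (12 - h) := by
    have h12 : 2 ^ (12 - h) * 2 ^ h = 4096 := by
      rw [← pow_add, show 12 - h + h = 12 by omega]; norm_num
    exact Nat.eq_of_mul_eq_mul_right (by positivity) (hB.trans h12.symm)
  have habs : |∑ x ∈ Z h, (if q x = true then (-1 : ℤ) else 1)| ≤ (#(Z h) : ℤ) := by
    refine (abs_sum_le_sum_abs _ _).trans ?_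
    have : ∑ x ∈ Z h, |(if q x = true then (-1 : ℤ) else 1)| = ∑ x ∈ Z h, (1 : ℤ) :=
      sum_congr rfl fun x _ => by split_ifs <;> simp
    rw [this, sum_const, nsmul_eq_mul, mul_one]
  -- the signed sum in terms of the count
  have hsgn : ∑ x, (if q x = true then (-1 : ℤ) else 1) = 4096 - 2 * (#(univ.filter fun x : Fin (6 + 6) → Bool => q x = true) : ℤ) := by
    have e : ∀ x, (if q x = true then (-1 : ℤ) else 1) = 1 - 2 * (if q x = true then (1 : ℤ) else 0) := fun x => by
      split_ifs <;> norm_num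
    rw [sum_congr rfl fun x _ => e x, sum_sub_distrib, sum_const, ← mul_sum, sum_boole, card_univ, Fintype.card_fun,
      Fintype.card_bool, Fintype.card_fin]
    norm_num
  set p := 2 ^ (11 - h) with hpdef
  have hp2 : 2 ^ (12 - h) = 2 * p := by
    rw [hpdef, show 12 - h = (11 - h) + 1 by omega, pow_succ]; ring
  rw [hA] at hsgn
  rw [hsgn, hZcard, hp2, Nat.cast_mul] at habs
  have hp : p ≤ 2048 := by
    rw [hpdef]
    calc 2 ^ (11 - h) ≤ 2 ^ 11 := Nat.pow_le_pow_right (by norm_num) (by omega)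
      _ = 2048 := by norm_num
  obtain ⟨h1, h2⟩ := abs_le.1 habs
  have h1' : -((2 : ℤ) * (p : ℤ)) ≤ 4096 - 2 * (#(univ.filter fun x : Fin (6 + 6) → Bool => q x = true) : ℤ) := by
    exact_mod_cast h1
  have h2' : (4096 : ℤ) - 2 * (#(univ.filter fun x : Fin (6 + 6) → Bool => q x = true) : ℤ) ≤ 2 * (p : ℤ) := by
    exact_mod_cast h2
  clear h1 h2 habs
  constructor <;> omega

/-- **The profile bound.**  For any Boolean `κ` on 12 bits with `e = #{κ = 1}` and any lower bounds `2048 ≤ #{x : κ x ≠ κ(x ⊕ a)} + N(a)`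
for `a ≠ 0`: `4095·2048 ≤ 2e(4096 − e) + Σ_{a ≠ 0} N(a)`.  (`Σ_a #{D_aκ = 1} = 2e(4096 − e)`, `sw_sum_deriv_card`.) [this work] -/
theorem tdq_profile_bound (κ : (Fin (6 + 6) → Bool) → Bool) (N : (Fin (6 + 6) → Bool) → ℕ)
    (hN : ∀ a : Fin (6 + 6) → Bool, a ≠ zeroVec →
      2048 ≤ #(univ.filter fun x : Fin (6 + 6) → Bool => (κ x ^^ κ (bxor x a)) = true) + N a) :
    4095 * 2048 ≤ 2 * #(univ.filter fun x : Fin (6 + 6) → Bool => κ x = true) *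
        (4096 - #(univ.filter fun x : Fin (6 + 6) → Bool => κ x = true)) + ∑ a ∈ univ.erase zeroVec, N a := by
  classical
  have hsum := sw_sum_deriv_card κ
  have hN' : (2 : ℕ) ^ (6 + 6) = 4096 := by norm_num
  rw [hN'] at hsum
  have h0 : #(univ.filter fun x => (κ x ^^ κ (bxor x (zeroVec : Fin (6 + 6) → Bool))) = true) = 0 := by
    rw [card_eq_zero, filter_eq_empty_iff]; intro x _; rw [bxor_zeroVec, Bool.xor_self]; exact Bool.false_ne_true
  have hsplit := sum_erase_add (s := (univ : Finset (Fin (6 + 6) → Bool))) (a := zeroVec)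
    (f := fun a => (#(univ.filter fun x => (κ x ^^ κ (bxor x a)) = true) : ℕ)) (mem_univ _)
  rw [h0, add_zero, hsum] at hsplit
  have hge : ∑ a ∈ (univ : Finset (Fin (6 + 6) → Bool)).erase zeroVec, 2048 ≤
      ∑ a ∈ (univ : Finset (Fin (6 + 6) → Bool)).erase zeroVec,
        (#(univ.filter fun x => (κ x ^^ κ (bxor x a)) = true) + N a) :=
    sum_le_sum fun a ha => hN a (ne_of_mem_erase ha)
  rw [sum_const, smul_eq_mul, sum_add_distrib, hsplit] at hge
  have hcard : #((univ : Finset (Fin (6 + 6) → Bool)).erase zeroVec) = 4095 := by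
    rw [card_erase_of_mem (mem_univ _), card_univ, Fintype.card_fun, Fintype.card_bool, Fintype.card_fin]; norm_num
  rw [hcard] at hge
  exact hge

/-- **Weight window from the profile.**  If the bounds `N` of `tdq_profile_bound` have `Σ_{a≠0} N(a) ≤ 1202303`, then
`1273 ≤ e ≤ 2823`; in particular a cubic support (`8 ∣ e`) then has `e ≥ 1280` or `e ≥ 2824`... i.e. `e ∉ [0, 1272]`.  [this work] -/
theorem tdq_weight_window_of_profile (κ : (Fin (6 + 6) → Bool) → Bool) (N : (Fin (6 + 6) → Bool) → ℕ)
    (hN : ∀ a : Fin (6 + 6) → Bool, a ≠ zeroVec →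
      2048 ≤ #(univ.filter fun x : Fin (6 + 6) → Bool => (κ x ^^ κ (bxor x a)) = true) + N a)
    (hP : ∑ a ∈ univ.erase zeroVec, N a ≤ 1202303) :
    1273 ≤ #(univ.filter fun x : Fin (6 + 6) → Bool => κ x = true) ∧
      #(univ.filter fun x : Fin (6 + 6) → Bool => κ x = true) ≤ 2823 := by
  have h := tdq_profile_bound κ N hN
  have hle : #(univ.filter fun x : Fin (6 + 6) → Bool => κ x = true) ≤ 4096 := by
    calc #(univ.filter fun x : Fin (6 + 6) → Bool => κ x = true) ≤ #(univ : Finset (Fin (6 + 6) → Bool)) := card_le_univ _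
      _ = 4096 := by rw [card_univ, Fintype.card_fun, Fintype.card_bool, Fintype.card_fin]; norm_num
  set e := #(univ.filter fun x : Fin (6 + 6) → Bool => κ x = true) with he
  have hZ : (4095 : ℤ) * 2048 ≤ 2 * (e : ℤ) * (4096 - (e : ℤ)) + 1202303 := by
    have hP' : ((∑ a ∈ univ.erase zeroVec, N a : ℕ) : ℤ) ≤ 1202303 := by exact_mod_cast hP
    have h' : ((4095 * 2048 : ℕ) : ℤ) ≤ ((2 * e * (4096 - e) + ∑ a ∈ univ.erase zeroVec, N a : ℕ) : ℤ) := by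
      exact_mod_cast h
    push_cast [Nat.cast_sub hle] at h'
    linarith
  constructor
  · by_contra hlt
    rw [not_le] at hlt
    have h776 : (776 : ℤ) ≤ 2048 - (e : ℤ) := by
      have : (e : ℤ) < 1273 := by exact_mod_cast hlt
      linarith
    have hsq : (776 : ℤ) * 776 ≤ (2048 - (e : ℤ)) * (2048 - (e : ℤ)) := mul_le_mul h776 h776 (by norm_num) (by linarith)
    nlinarith [hsq]
  · by_contra hgt
    rw [not_le] at hgt
    have h776 : (776 : ℤ) ≤ (e : ℤ) - 2048 := by
      have : (2823 : ℤ) < (e : ℤ) := by exact_mod_cast hgt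
      linarith
    have hsq : (776 : ℤ) * 776 ≤ ((e : ℤ) - 2048) * ((e : ℤ) - 2048) := mul_le_mul h776 h776 (by norm_num) (by linarith)
    nlinarith [hsq]

end Profile

end Summit.QuantumAdvantage.QuantumAdvantage.Theorems.CubicForrelation.NearExactIsExact

end
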